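import Mathlib
import Summits.Ventures.HodgeRepro.Tier4.Common.AdelicDefs
import Summits.Ventures.HodgeRepro.Tier4.Line1.RationalPoints
import Summits.Ventures.HodgeRepro.Tier4.Line1.LocallyCompactGA
import Summits.Ventures.HodgeRepro.Tier4.Line1.SecondCountableGA
import Summits.Ventures.HodgeRepro.Tier4.Line1.PrincipalDiscrete
import Summits.Ventures.HodgeRepro.Tier4.Line1.AddFundamentalDomainOfCompact
import Summits.Ventures.HodgeRepro.Tier4.Line1.AdeleCocompact

/-!
# Tier4/Line1/PairBlichfeldt — adelic Blichfeldt for `k² ⊆ 𝔸_k²`, infinite Haar mass, finiteness of `k² ∩ compact`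

Blind re-derivation cell `pub-hodge-repro`, Tier 4 (README §9–§10), seat t4-L1-p2 (prover, LINE L1, gen 0).
Support for the cocompactness cut R-c of LINE L1 (t4-L1-p5's rung file `I1c-rungs-sig.lean`; p3's S12799 residual
(ii) of `hstab`, my S12847): FUJISAKI FOR THE NORM-ONE TORUS `{(x, y) ∈ 𝔸_k² : x² + d y² = 1}`, proved WITHOUT
absolute values, place decompositions or idele topologies.  `𝔸_k[Ω]` (`Ω² = −d`) is Mathlib's
`QuadraticAlgebra (𝔸_k) (−d) 0`; pairs `𝔸_k × 𝔸_k` carry the topology and the Haar measure, `equivProd` moves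
between the two.  HC_CM is NOT proved by anyone in this repository.

CONTENT (module 2 of 3): (F2) `exists_ne_zero_rational_mem_sub_pair` — p5's adelic Blichfeldt
(`AdelicBlichfeldt.exists_ne_zero_rational_mem_sub_of`) re-run for the lattice `k² ⊆ 𝔸_k × 𝔸_k` from the
unconditional «`𝔸_k / k` is compact» (`AdeleCocompact.exists_compact_add_principal`); (F3)
`exists_isCompact_lt_measure_pair` — Haar measure on the non-compact σ-compact group `𝔸_k²` has infinite mass, so
some compact set has measure above any finite bound; (F4) `finite_rational_pair_inter_of_isCompact` — `k²` meets a
compact subset of `𝔸_k²` in finitely many points (p5's `finite_principal_inter_of_isCompact` on both projections).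
-/

set_option autoImplicit false

noncomputable section

namespace Summit.Ventures.HodgeRepro.Tier4.Line1

open NumberField MeasureTheory Measure Topology Common Set
open scoped ENNReal NNReal Pointwise

section PairLattice

variable (k : Type) [Field k] [NumberField k]

/-- the principal lattice `k² ⊆ 𝔸_k²` is discrete -/
theorem principalPair_discrete :
    DiscreteTopology ((AdeleRing.principalSubgroup (𝓞 k) k).prod (AdeleRing.principalSubgroup (𝓞 k) k)) := by
  haveI := principalSubgroup_discrete k
  refine DiscreteTopology.of_continuous_injective
    (f := fun γ : (AdeleRing.principalSubgroup (𝓞 k) k).prod (AdeleRing.principalSubgroup (𝓞 k) k) =>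
      ((⟨(γ : Ad k × Ad k).1, γ.2.1⟩ : AdeleRing.principalSubgroup (𝓞 k) k),
        (⟨(γ : Ad k × Ad k).2, γ.2.2⟩ : AdeleRing.principalSubgroup (𝓞 k) k))) ?_ ?_
  · exact (Continuous.subtype_mk (continuous_fst.comp continuous_subtype_val) _).prodMk
      (Continuous.subtype_mk (continuous_snd.comp continuous_subtype_val) _)
  · intro γ δ h
    apply Subtype.ext
    have h1 := congrArg (fun q => (q.1 : Ad k)) h
    have h2 := congrArg (fun q => (q.2 : Ad k)) h
    exact Prod.ext h1 h2

/-- the principal lattice `k² ⊆ 𝔸_k²` is countable -/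
theorem principalPair_countable :
    Countable ((AdeleRing.principalSubgroup (𝓞 k) k).prod (AdeleRing.principalSubgroup (𝓞 k) k)) := by
  haveI : Countable k := countable_numberField' k
  classical
  let φ : (AdeleRing.principalSubgroup (𝓞 k) k).prod (AdeleRing.principalSubgroup (𝓞 k) k) → k × k :=
    fun γ => (Classical.choose γ.2.1, Classical.choose γ.2.2)
  have hφ : Function.Injective φ := by
    intro γ δ h
    apply Subtype.ext
    have hγ1 := Classical.choose_spec γ.2.1
    have hγ2 := Classical.choose_spec γ.2.2
    have hδ1 := Classical.choose_spec δ.2.1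
    have hδ2 := Classical.choose_spec δ.2.2
    have e1 := congrArg Prod.fst h
    have e2 := congrArg Prod.snd h
    simp only [φ] at e1 e2
    refine Prod.ext ?_ ?_
    · rw [← hγ1, ← hδ1, e1]
    · rw [← hγ2, ← hδ2, e2]
  exact hφ.countable

/-- **(F2) adelic Blichfeldt for `k² ⊆ 𝔸_k²`**: for every Haar measure `μ` on `𝔸_k²` there is a finite constant
`c` such that every measurable `S` with `μ S > c` contains two points differing by a non-zero rational pair. -/
theorem exists_ne_zero_rational_mem_sub_pair [MeasurableSpace (Ad k × Ad k)] [BorelSpace (Ad k × Ad k)]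
    (μ : Measure (Ad k × Ad k)) [μ.IsAddHaarMeasure] :
    ∃ c : ℝ≥0∞, c < ∞ ∧ ∀ S : Set (Ad k × Ad k), MeasurableSet S → c < μ S →
      ∃ a b : k, (a ≠ 0 ∨ b ≠ 0) ∧ ∃ s ∈ S, ∃ t ∈ S,
        s - t = (algebraMap k (Ad k) a, algebraMap k (Ad k) b) := by
  classical
  obtain ⟨C, hC, hcov⟩ := exists_compact_add_principal k
  haveI := t2Space_adeleRing k
  let L : AddSubgroup (Ad k × Ad k) :=
    (AdeleRing.principalSubgroup (𝓞 k) k).prod (AdeleRing.principalSubgroup (𝓞 k) k)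
  haveI : DiscreteTopology L := principalPair_discrete k
  haveI : Countable L := principalPair_countable k
  have hC2 : IsCompact (C ×ˢ C) := hC.prod hC
  have hcov2 : ∀ x : Ad k × Ad k, ∃ γ : L, ∃ c ∈ C ×ˢ C, x = (γ : Ad k × Ad k) + c := by
    intro x
    obtain ⟨a, ha⟩ := hcov x.1
    obtain ⟨b, hb⟩ := hcov x.2
    refine ⟨⟨(algebraMap k (Ad k) a, algebraMap k (Ad k) b), ⟨⟨a, rfl⟩, ⟨b, rfl⟩⟩⟩,
      (x.1 - algebraMap k (Ad k) a, x.2 - algebraMap k (Ad k) b), ⟨ha, hb⟩, ?_⟩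
    ext <;> simp
  obtain ⟨F, hF, hFc⟩ :=
    exists_isAddFundamentalDomain_isCompact_closure_of_isCompact L μ hC2 hcov2
  refine ⟨μ F, ?_, ?_⟩
  · exact lt_of_le_of_lt (measure_mono subset_closure) hFc.measure_lt_top
  · intro S hS hμ
    obtain ⟨γ₁, γ₂, hne, hdisj⟩ :=
      exists_pair_mem_lattice_not_disjoint_vadd hF hS.nullMeasurableSet hμ
    rw [Set.not_disjoint_iff] at hdisj
    obtain ⟨z, hz₁, hz₂⟩ := hdisj
    rw [Set.mem_vadd_set] at hz₁ hz₂
    obtain ⟨s, hs, hzs⟩ := hz₁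
    obtain ⟨t, ht, hzt⟩ := hz₂
    have hdiff : s - t = (γ₂ : Ad k × Ad k) - γ₁ := by
      have h1 : (γ₁ : Ad k × Ad k) + s = z := hzs
      have h2 : (γ₂ : Ad k × Ad k) + t = z := hzt
      rw [← h2] at h1
      calc s - t = ((γ₁ : Ad k × Ad k) + s) - ((γ₁ : Ad k × Ad k) + t) := by abel
        _ = ((γ₂ : Ad k × Ad k) + t) - ((γ₁ : Ad k × Ad k) + t) := by rw [h1]
        _ = (γ₂ : Ad k × Ad k) - γ₁ := by abel
    have hmem : ((γ₂ : Ad k × Ad k) - γ₁) ∈ L := L.sub_mem γ₂.2 γ₁.2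
    obtain ⟨a, ha⟩ := hmem.1
    obtain ⟨b, hb⟩ := hmem.2
    refine ⟨a, b, ?_, s, hs, t, ht, ?_⟩
    · by_contra hab
      have ha0 : a = 0 := by_contra fun h => hab (Or.inl h)
      have hb0 : b = 0 := by_contra fun h => hab (Or.inr h)
      apply hne
      apply Subtype.ext
      have h0 : (γ₂ : Ad k × Ad k) - γ₁ = 0 := by
        ext
        · rw [← ha, ha0, map_zero]; rfl
        · rw [← hb, hb0, map_zero]; rfl
      exact (sub_eq_zero.1 h0).symm
    · rw [hdiff]
      ext
      · exact ha.symm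
      · exact hb.symm

end PairLattice

section BigCompact

variable (k : Type) [Field k] [NumberField k]

omit [NumberField k] in
/-- The completion of `k` at an infinite place is not compact (the naturals are unbounded in norm). -/
theorem noncompactSpace_completion_infinitePlace (w : InfinitePlace k) : NoncompactSpace w.Completion := by
  refine ⟨fun hc => ?_⟩
  obtain ⟨R, hR⟩ := Bornology.IsBounded.exists_norm_le hc.isBounded
  obtain ⟨n, hn⟩ := exists_nat_gt R
  have h1 : ‖((n : k) : w.Completion)‖ = n := by
    rw [InfinitePlace.Completion.norm_coe]
    show w (n : k) = n
    rw [← InfinitePlace.mk_embedding w, InfinitePlace.apply, map_natCast, Complex.norm_natCast]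
  have h2 := hR ((n : k) : w.Completion) (Set.mem_univ _)
  rw [h1] at h2
  exact absurd (lt_of_lt_of_le hn h2) (lt_irrefl _)

/-- `𝔸_k` is not compact (an infinite place is a non-compact completion). -/
theorem noncompactSpace_adeleRing : NoncompactSpace (Ad k) := by
  classical
  obtain ⟨w⟩ := (inferInstance : Nonempty (InfinitePlace k))
  haveI := noncompactSpace_completion_infinitePlace k w
  refine ⟨fun hc => ?_⟩
  have hf : Continuous fun x : Ad k => x.1 w := (continuous_apply w).comp continuous_fst
  have hsurj : Function.Surjective fun x : Ad k => x.1 w := by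
    intro y
    refine ⟨((Function.update (0 : (v : InfinitePlace k) → v.Completion) w y : InfiniteAdeleRing k), 0), ?_⟩
    show Function.update (0 : (v : InfinitePlace k) → v.Completion) w y w = y
    exact Function.update_self w y 0
  have h1 : IsCompact (Set.univ : Set w.Completion) := by
    rw [← Set.image_univ_of_surjective hsurj]
    exact hc.image hf
  exact noncompact_univ w.Completion h1

/-- **(F3) a compact subset of `𝔸_k²` of Haar measure larger than any given finite bound**: Haar measure on the
non-compact σ-compact group `𝔸_k²` has infinite mass. -/
theorem exists_isCompact_lt_measure_pair [MeasurableSpace (Ad k × Ad k)] [BorelSpace (Ad k × Ad k)]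
    (μ : Measure (Ad k × Ad k)) [μ.IsAddHaarMeasure] (c : ℝ≥0∞) (hc : c < ∞) :
    ∃ K : Set (Ad k × Ad k), IsCompact K ∧ c < μ K := by
  haveI := locallyCompactSpace_adeleRing k
  haveI := secondCountable_adeleRing k
  haveI := noncompactSpace_adeleRing k
  haveI : NoncompactSpace (Ad k × Ad k) := Prod.noncompactSpace_left
  have huniv : μ Set.univ = ∞ := measure_univ_of_isAddLeftInvariant μ
  have hmono : Monotone (compactCovering (Ad k × Ad k)) := fun m n h => compactCovering_subset _ h
  have hsup : μ (⋃ n, compactCovering (Ad k × Ad k) n) = ⨆ n, μ (compactCovering (Ad k × Ad k) n) :=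
    hmono.measure_iUnion
  rw [iUnion_compactCovering, huniv] at hsup
  have hlt : c < ⨆ n, μ (compactCovering (Ad k × Ad k) n) := by
    rw [← hsup]
    exact hc
  obtain ⟨n, hn⟩ := lt_iSup_iff.1 hlt
  exact ⟨compactCovering (Ad k × Ad k) n, isCompact_compactCovering _ n, hn⟩

/-- **(F4) `k²` meets every compact subset of `𝔸_k²` in finitely many points** (both projections are
compact, and `k` meets a compact subset of `𝔸_k` in finitely many points). -/
theorem finite_rational_pair_inter_of_isCompact {C : Set (Ad k × Ad k)} (hC : IsCompact C) :
    {p : k × k | (algebraMap k (Ad k) p.1, algebraMap k (Ad k) p.2) ∈ C}.Finite := by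
  have h1 := finite_principal_inter_of_isCompact k (hC.image continuous_fst)
  have h2 := finite_principal_inter_of_isCompact k (hC.image continuous_snd)
  refine (h1.prod h2).subset ?_
  rintro ⟨a, b⟩ hab
  exact ⟨⟨_, hab, rfl⟩, ⟨_, hab, rfl⟩⟩

end BigCompact

end Summit.Ventures.HodgeRepro.Tier4.Line1

end
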